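import Mathlib.Algebra.MvPolynomial.Funext
import Mathlib.Algebra.Polynomial.BigOperators
import Literature.NumberTheory.Automorphic.HarishChandraParabolicProjection
import Literature.NumberTheory.Automorphic.HarishChandraGLIsomorphism
import Literature.NumberTheory.Automorphic.HarishChandraGLExistence
import HarnessLib

/-!
# `Z(𝔪)` is integral over `Z(𝔤)` modulo `U(𝔤)𝔲` for the maximal parabolics of `𝔤𝔩_n`

Topic `NumberTheory/Automorphic`; sequel of `HarishChandraLeviBlocks` and
`HarishChandraParabolicProjection` (the complex setting of `HarishChandraCore`: `T` a finite type,
`𝔤 T m = T → 𝔤𝔩_m(ℂ)`, `U = U(𝔤 T (k+l))`, `𝔪 = 𝔤 T k × 𝔤 T l`, `𝔲` the upper right block,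
`U(𝔤)𝔲` the left ideal `uIdeal`, `leviMap : U(𝔤 T k) ⊗ U(𝔤 T l) ≅ U(𝔪) ⊆ U`).

**Main theorem** (`exists_monic_mem_uIdeal`, and `exists_monic_mem_uIdeal_gl` for the
complexification `T = (𝕜 →ₐ[ℝ] ℂ)` of `𝔤𝔩_{k+l}(𝕜)`, `𝕜 = ℝ` or `ℂ`). For every element `y` of the
centre `Z(U(𝔤 T k)) ⊗ Z(U(𝔤 T l))` of `U(𝔪)` there are central elements `c₀, …, c_{d-1} ∈ Z(U(𝔤))`
with

  `y^d + c_{d-1} y^{d-1} + ⋯ + c₀ ∈ U(𝔤)𝔲.`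

This is the form in which **`Z(𝔪)` is a finitely generated module over the image of `Z(𝔤)` under
the Harish-Chandra homomorphism `μ_𝔭 : Z(𝔤) → Z(𝔪)`** (Harish-Chandra; Moeglin–Waldspurger 1995,
I.2.17: "`𝔷^M` is a finitely generated `i(𝔷)`-module ([HC2])"; Knapp–Vogan 1995, Thm. 4.129 ff. /
Prop. 5.34 context) enters the theory of constant terms: if `φ` is annihilated by an ideal of finite
codimension of `Z(𝔤)` acting by LEFT-invariant... more precisely, for a smooth function `φ` on
`N(𝔸)\G(𝔸)` on which `Z(𝔤)` acts through a finite-dimensional quotient, the left ideal `U(𝔤)𝔲`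
acts by zero through left translations, so every `y ∈ Z(𝔪)` acts algebraically on `φ`: the
constant terms of automorphic forms are `Z(𝔪)`-finite (Moeglin–Waldspurger I.2.17; Borel–Jacquet
1979, 4.3–4.4; the Levi step of Harish-Chandra's finiteness theorem 4.3 (i)).

Proof (classical, through Harish-Chandra's isomorphism; everything below is proved):

1. `lift_leviMap_center_hw` — on a highest weight vector `v` of weight `λ` (any representation of
   `𝔤 T (k+l)`), `leviMap(y)` acts by the scalar `(blockPoly y)(λ)`, where
   `blockPoly : Z(U(𝔤 T k)) ⊗ Z(U(𝔤 T l)) → ℂ[x_{τ,i}]` is `γ_k ⊗ γ_l` (the Harish-Chandra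
   projections `HCCore.hcProj` of the blocks, in the block variables): restrict the representation
   to the blocks (`isHighestWeightVectorC_comp_inclLeft/Right`).
2. `blockPoly_injective` — `γ_k ⊗ γ_l` is injective (injectivity of the Harish-Chandra projection
   on each centre, `HCCore.eq_zero_of_hcProj_eq_zero`, and partial evaluation in the variables of
   the first block).
3. `weylOrbitProd` — for `p = blockPoly y` shifted by `ρ`, the polynomial
   `Q(Y) = ∏_{σ ∈ W} (Y - σ·p)` over the Weyl group `W = (T → 𝔖_{k+l})` is monic with
   `W`-symmetric coefficients and `Q(p) = 0`; by the surjectivity half of Harish-Chandra's theorem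
   (`HCCore.injective_and_range_eq_of_hasHWProperty`) its coefficients are `γ(c_i)`, `c_i ∈ Z(𝔤)`.
4. Hence `q = y^d + ∑ c_i y^i` kills every highest weight vector; `q` commutes with
   `H₀ = diag(1_k, 0_l)`, so `q = μ(q) + r` with `r ∈ U(𝔤)𝔲` (`sub_leviProj_mem_uIdeal`) and
   `μ(q) = leviMap(y')` for an explicit `y' ∈ Z_k ⊗ Z_l` (`μ` is multiplicative and maps `Z(𝔤)` to
   `Z_k ⊗ Z_l`, `exists_center_tmul_eq_leviProj`); as `r` kills highest weight vectors too,
   `blockPoly y'` vanishes at all dominant integral weights (highest weight vectors of these weights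
   exist, `HighestWeightGL`), hence `y' = 0` by Zariski density and step 2, i.e. `q = r ∈ U(𝔤)𝔲`.

The linear orders on the index types needed by the PBW arguments of the previous two files (block
embeddings increasing, zones `𝔲⁻ < 𝔪 < 𝔲` increasing) are constructed here (`lexOrder`,
`parabolicOrder`) and discharged inside the proofs; the main statements mention no order.
Definitions and theorems only, no named fact.

## References

* C. Moeglin, J.-L. Waldspurger, *Spectral decomposition and Eisenstein series* (1995), I.2.17
  [MoeglinWaldspurger1995].
* A. W. Knapp, D. A. Vogan, *Cohomological Induction and Unitary Representations* (1995), §IV.7–8,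
  Thm. 4.95, Lemma 4.127, Thm. 4.129 [KnappVogan1995].
* Harish-Chandra, *Automorphic forms on semisimple Lie groups*, LNM 62 (1968), §2–§4
  [HarishChandra1968].
* A. Borel, H. Jacquet, *Automorphic forms and automorphic representations*, Corvallis (1979),
  4.3–4.4 [BorelJacquet1979].
-/

noncomputable section

-- Mathlib idiom (Mathlib/Algebra/Lie/OfAssociative.lean): commutator brackets on associative algebras
attribute [local instance 100] LieRing.ofAssociativeRing

open UniversalEnvelopingAlgebra TensorProduct MvPolynomial Literature.Algebra.Lie.PBW Literature.Algebra.Lie.ChevalleyGL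
open Literature.RingTheory.MvPolynomial.BlockSymmetric

namespace Literature.NumberTheory.Automorphic.HCLevi

open HCCore

variable {T : Type*} [Fintype T] [DecidableEq T] {k l : ℕ}

/-! ### Restriction of highest weight vectors to the Levi blocks -/

section Restrict

variable {V : Type*} [AddCommGroup V] [Module ℂ V] {ρ : 𝔤 T (k + l) →ₗ⁅ℂ⁆ Module.End ℂ V}
  {lam : T → Fin (k + l) → ℂ} {v : V}

omit [Fintype T] [DecidableEq T] in
/-- The first block embedding on diagonal matrices. [folklore] -/
theorem inclLeft_diagonal (h : T → Fin k → ℂ) :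
    inclLeft T k l (fun τ ↦ Matrix.diagonal (h τ)) =
      fun τ ↦ Matrix.diagonal fun i ↦ Fin.addCases (h τ) (fun _ ↦ (0 : ℂ)) i := by
  funext τ
  ext a b
  rw [inclLeft_apply, Matrix.diagonal_apply]
  induction a using Fin.addCases with
  | left a =>
    induction b using Fin.addCases with
    | left b =>
      rw [blockDiag_castAdd_castAdd, Matrix.diagonal_apply]
      simp only [Fin.castAdd_inj, Fin.addCases_left]
    | right b => rw [blockDiag_castAdd_natAdd, if_neg (castAdd_ne_natAdd a b)]
  | right a =>
    induction b using Fin.addCases with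
    | left b => rw [blockDiag_natAdd_castAdd, if_neg (fun h ↦ castAdd_ne_natAdd b a h.symm)]
    | right b =>
      rw [blockDiag_natAdd_natAdd, Matrix.zero_apply]
      simp only [Fin.natAdd_inj, Fin.addCases_right]
      split_ifs <;> rfl

omit [Fintype T] [DecidableEq T] in
/-- The second block embedding on diagonal matrices. [folklore] -/
theorem inclRight_diagonal (h : T → Fin l → ℂ) :
    inclRight T k l (fun τ ↦ Matrix.diagonal (h τ)) =
      fun τ ↦ Matrix.diagonal fun i ↦ Fin.addCases (fun _ ↦ (0 : ℂ)) (h τ) i := by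
  funext τ
  ext a b
  rw [inclRight_apply, Matrix.diagonal_apply]
  induction a using Fin.addCases with
  | left a =>
    induction b using Fin.addCases with
    | left b =>
      rw [blockDiag_castAdd_castAdd, Matrix.zero_apply]
      simp only [Fin.castAdd_inj, Fin.addCases_left]
      split_ifs <;> rfl
    | right b => rw [blockDiag_castAdd_natAdd, if_neg (castAdd_ne_natAdd a b)]
  | right a =>
    induction b using Fin.addCases with
    | left b => rw [blockDiag_natAdd_castAdd, if_neg (fun h ↦ castAdd_ne_natAdd b a h.symm)]
    | right b =>
      rw [blockDiag_natAdd_natAdd, Matrix.diagonal_apply]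
      simp only [Fin.natAdd_inj, Fin.addCases_right]

omit [DecidableEq T] in
/-- **A highest weight vector restricts to a highest weight vector of the first block**, of weight
`λ|_{first k coordinates}`. [folklore] -/
theorem isHighestWeightVectorC_comp_inclLeft (hv : IsHighestWeightVectorC ρ lam v) :
    IsHighestWeightVectorC (ρ.comp (inclLeft T k l)) (fun τ a ↦ lam τ (Fin.castAdd l a)) v := by
  refine ⟨hv.1, fun X hX ↦ ?_, fun h ↦ ?_⟩
  · rw [LieHom.comp_apply]
    refine hv.2.1 _ fun τ i j hji ↦ ?_
    rw [inclLeft_apply]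
    induction i using Fin.addCases with
    | left a =>
      induction j using Fin.addCases with
      | left b =>
        rw [blockDiag_castAdd_castAdd]
        exact hX τ a b (by rw [Fin.le_def] at hji ⊢; simpa using hji)
      | right b => rw [blockDiag_castAdd_natAdd]
    | right a =>
      induction j using Fin.addCases with
      | left b => rw [blockDiag_natAdd_castAdd]
      | right b => rw [blockDiag_natAdd_natAdd, Matrix.zero_apply]
  · rw [LieHom.comp_apply, inclLeft_diagonal, hv.2.2]
    congr 1
    refine Finset.sum_congr rfl fun τ _ ↦ ?_
    rw [Fin.sum_univ_add]
    simp only [Fin.addCases_left, Fin.addCases_right, mul_zero, Finset.sum_const_zero, add_zero]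

omit [DecidableEq T] in
/-- **A highest weight vector restricts to a highest weight vector of the second block**, of weight
`λ|_{last l coordinates}`. [folklore] -/
theorem isHighestWeightVectorC_comp_inclRight (hv : IsHighestWeightVectorC ρ lam v) :
    IsHighestWeightVectorC (ρ.comp (inclRight T k l)) (fun τ b ↦ lam τ (Fin.natAdd k b)) v := by
  refine ⟨hv.1, fun X hX ↦ ?_, fun h ↦ ?_⟩
  · rw [LieHom.comp_apply]
    refine hv.2.1 _ fun τ i j hji ↦ ?_
    rw [inclRight_apply]
    induction i using Fin.addCases with
    | left a =>
      induction j using Fin.addCases with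
      | left b => rw [blockDiag_castAdd_castAdd, Matrix.zero_apply]
      | right b => rw [blockDiag_castAdd_natAdd]
    | right a =>
      induction j using Fin.addCases with
      | left b => rw [blockDiag_natAdd_castAdd]
      | right b =>
        rw [blockDiag_natAdd_natAdd]
        exact hX τ a b (by rw [Fin.le_def] at hji ⊢; simpa using hji)
  · rw [LieHom.comp_apply, inclRight_diagonal, hv.2.2]
    congr 1
    refine Finset.sum_congr rfl fun τ _ ↦ ?_
    rw [Fin.sum_univ_add]
    simp only [Fin.addCases_left, Fin.addCases_right, mul_zero, Finset.sum_const_zero, zero_add]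

end Restrict

/-! ### The Harish-Chandra polynomial of an element of `Z_k ⊗ Z_l` and its action on highest weight vectors -/

section BlockPoly

local notation "𝔘[" m "]" => UniversalEnvelopingAlgebra ℂ (𝔤 T m)
local notation "Z[" m "]" => Subalgebra.center ℂ (UniversalEnvelopingAlgebra ℂ (𝔤 T m))

variable (T k l) in
/-- The Harish-Chandra projection of the first block, as a polynomial in the variables
`x_{τ, i}`, `i < k`, of `𝔤 T (k+l)`: `γ_k` followed by the renaming `(τ, a) ↦ (τ, castAdd a)`. [folklore] -/
def hcPolyLeft : Z[k] →ₗ[ℂ] MvPolynomial (T × Fin (k + l)) ℂ :=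
  (rename fun p : T × Fin k ↦ (p.1, Fin.castAdd l p.2)).toLinearMap ∘ₗ hcProj T k ∘ₗ
    (Subalgebra.center ℂ 𝔘[k]).val.toLinearMap

variable (T k l) in
/-- The Harish-Chandra projection of the second block, in the variables `x_{τ, k + b}`. [folklore] -/
def hcPolyRight : Z[l] →ₗ[ℂ] MvPolynomial (T × Fin (k + l)) ℂ :=
  (rename fun p : T × Fin l ↦ (p.1, Fin.natAdd k p.2)).toLinearMap ∘ₗ hcProj T l ∘ₗ
    (Subalgebra.center ℂ 𝔘[l]).val.toLinearMap

/-- Unfolding `hcPolyLeft`. [folklore] -/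
theorem hcPolyLeft_apply (a : Z[k]) :
    hcPolyLeft T k l a = rename (fun p : T × Fin k ↦ (p.1, Fin.castAdd l p.2)) (hcProj T k (a : 𝔘[k])) := rfl

/-- Unfolding `hcPolyRight`. [folklore] -/
theorem hcPolyRight_apply (b : Z[l]) :
    hcPolyRight T k l b = rename (fun p : T × Fin l ↦ (p.1, Fin.natAdd k p.2)) (hcProj T l (b : 𝔘[l])) := rfl

variable (T k l) in
/-- **The Harish-Chandra polynomial `γ_k ⊗ γ_l` on `Z(U(𝔤 T k)) ⊗ Z(U(𝔤 T l))`**: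
`a ⊗ b ↦ γ_k(a)(x_{τ,i<k}) · γ_l(b)(x_{τ,i≥k})`, a polynomial on `𝔥^* = ∏_τ ℂ^{k+l}`. [folklore] -/
def blockPoly : Z[k] ⊗[ℂ] Z[l] →ₗ[ℂ] MvPolynomial (T × Fin (k + l)) ℂ :=
  TensorProduct.lift ((LinearMap.mul ℂ (MvPolynomial (T × Fin (k + l)) ℂ)).compl₁₂ (hcPolyLeft T k l) (hcPolyRight T k l))

/-- `blockPoly` on pure tensors. [folklore] -/
@[simp]
theorem blockPoly_tmul (a : Z[k]) (b : Z[l]) : blockPoly T k l (a ⊗ₜ b) = hcPolyLeft T k l a * hcPolyRight T k l b :=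
  TensorProduct.lift.tmul a b

/-- The value of `blockPoly` at a weight `λ` is the product of the values of the two
Harish-Chandra projections at the restrictions of `λ` to the blocks. [folklore] -/
theorem eval_blockPoly_tmul (lam : T → Fin (k + l) → ℂ) (a : Z[k]) (b : Z[l]) :
    eval (fun p ↦ lam p.1 p.2) (blockPoly T k l (a ⊗ₜ b)) =
      eval (fun p : T × Fin k ↦ lam p.1 (Fin.castAdd l p.2)) (hcProj T k (a : 𝔘[k])) *
        eval (fun p : T × Fin l ↦ lam p.1 (Fin.natAdd k p.2)) (hcProj T l (b : 𝔘[l])) := by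
  rw [blockPoly_tmul, map_mul, hcPolyLeft_apply, hcPolyRight_apply, eval_rename, eval_rename]
  rfl

/-- **`leviMap` of a tensor of central elements acts on a highest weight vector of weight `λ` by the
scalar `(blockPoly y)(λ)`** (restriction to the blocks and `HCCore.lift_center_hw`).
[cite: KnappVogan1995, Thm. 4.95 with (4.99)] -/
theorem lift_leviMap_center_hw {V : Type*} [AddCommGroup V] [Module ℂ V] {ρ : 𝔤 T (k + l) →ₗ⁅ℂ⁆ Module.End ℂ V}
    {lam : T → Fin (k + l) → ℂ} {v : V} (hv : IsHighestWeightVectorC ρ lam v) (y : Z[k] ⊗[ℂ] Z[l]) :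
    lift ℂ ρ (leviMap T k l (Algebra.TensorProduct.map (Subalgebra.center ℂ 𝔘[k]).val
      (Subalgebra.center ℂ 𝔘[l]).val y)) v = eval (fun p ↦ lam p.1 p.2) (blockPoly T k l y) • v := by
  induction y using TensorProduct.induction_on with
  | zero => simp only [map_zero, LinearMap.zero_apply, zero_smul]
  | tmul a b =>
    rw [Algebra.TensorProduct.map_tmul, leviMap_tmul, map_mul, Module.End.mul_apply, Subalgebra.coe_val,
      Subalgebra.coe_val, ← lift_comp_inclRight, lift_center_hw (isHighestWeightVectorC_comp_inclRight hv) b.2,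
      map_smul, ← lift_comp_inclLeft, lift_center_hw (isHighestWeightVectorC_comp_inclLeft hv) a.2, smul_smul,
      eval_blockPoly_tmul, mul_comm]
  | add x y hx hy =>
    rw [map_add, map_add, map_add, LinearMap.add_apply, hx, hy, map_add, map_add, add_smul]

/-! ### Injectivity of `γ_k ⊗ γ_l` -/

/-- Partial evaluation of the first block of variables at a point `μ₁`, as an algebra map to the
polynomials in the variables of the second block. [folklore] -/
def pevalLeft (μ₁ : T → Fin k → ℂ) : MvPolynomial (T × Fin (k + l)) ℂ →ₐ[ℂ] MvPolynomial (T × Fin l) ℂ :=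
  aeval fun p : T × Fin (k + l) ↦ Fin.addCases (fun a ↦ C (μ₁ p.1 a)) (fun b ↦ X (p.1, b)) p.2

/-- Partial evaluation of a polynomial in the first block of variables is a constant. [folklore] -/
theorem pevalLeft_hcPolyLeft (μ₁ : T → Fin k → ℂ) (a : Z[k]) :
    pevalLeft μ₁ (hcPolyLeft T k l a) = C (eval (fun p : T × Fin k ↦ μ₁ p.1 p.2) (hcProj T k (a : 𝔘[k]))) := by
  rw [hcPolyLeft_apply, pevalLeft, aeval_rename]
  have e : (fun p : T × Fin (k + l) ↦ Fin.addCases (motive := fun _ ↦ MvPolynomial (T × Fin l) ℂ)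
      (fun a ↦ C (μ₁ p.1 a)) (fun b ↦ X (p.1, b)) p.2) ∘ (fun p : T × Fin k ↦ (p.1, Fin.castAdd l p.2)) =
      fun p ↦ C (μ₁ p.1 p.2) := by
    funext p
    simp only [Function.comp_apply, Fin.addCases_left]
  rw [e]
  -- `aeval (C ∘ g) P = C (eval g P)`
  rw [MvPolynomial.eval_eq, aeval_def, eval₂_eq]
  simp only [map_sum, map_mul, map_prod, map_pow, algebraMap_eq]

/-- Partial evaluation of a polynomial in the second block of variables is the same polynomial (in
the variables of the second block). [folklore] -/
theorem pevalLeft_hcPolyRight (μ₁ : T → Fin k → ℂ) (b : Z[l]) :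
    pevalLeft μ₁ (hcPolyRight T k l b) = hcProj T l (b : 𝔘[l]) := by
  rw [hcPolyRight_apply, pevalLeft, aeval_rename]
  have e : (fun p : T × Fin (k + l) ↦ Fin.addCases (motive := fun _ ↦ MvPolynomial (T × Fin l) ℂ)
      (fun a ↦ C (μ₁ p.1 a)) (fun b ↦ X (p.1, b)) p.2) ∘ (fun p : T × Fin l ↦ (p.1, Fin.natAdd k p.2)) = X := by
    funext p
    simp only [Function.comp_apply, Fin.addCases_right]
  rw [e, aeval_X_left, AlgHom.id_apply]

/-- **`γ_k ⊗ γ_l` is injective** on `Z(U(𝔤 T k)) ⊗ Z(U(𝔤 T l))`: injectivity of the Harish-Chandra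
projection on each centre (`HCCore.eq_zero_of_hcProj_eq_zero`, Chevalley restriction) and
separation of the two blocks of variables by partial evaluation.
[cite: KnappVogan1995, Thm. 4.95] -/
theorem blockPoly_injective : Function.Injective (blockPoly T k l) := by
  rw [← LinearMap.ker_eq_bot, Submodule.eq_bot_iff]
  intro y hy
  rw [LinearMap.mem_ker] at hy
  -- expand `y = ∑_j a_j ⊗ ℬ_j` in a basis `ℬ` of `Z_l`
  let ℬ := Module.Free.chooseBasis ℂ Z[l]
  obtain ⟨b, rfl⟩ := TensorProduct.eq_repr_basis_right ℬ y
  -- the polynomials `γ_l(ℬ_j)` are linearly independent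
  have hind : LinearIndependent ℂ fun j ↦ hcProj T l ((ℬ j : Z[l]) : 𝔘[l]) := by
    have h := ℬ.linearIndependent.map' ((hcProj T l) ∘ₗ (Subalgebra.center ℂ 𝔘[l]).val.toLinearMap) ?_
    · exact h
    · rw [LinearMap.ker_eq_bot]
      intro z z' hzz'
      simp only [LinearMap.comp_apply, AlgHom.toLinearMap_apply, Subalgebra.coe_val] at hzz'
      have h0 : hcProj T l ((z : 𝔘[l]) - z') = 0 := by rw [map_sub, hzz', sub_self]
      exact Subtype.ext (sub_eq_zero.mp (eq_zero_of_hcProj_eq_zero (Subalgebra.sub_mem _ z.2 z'.2) h0))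
  -- partial evaluation at every point of the first block
  have hcoef : ∀ j ∈ b.support, ∀ μ₁ : T → Fin k → ℂ,
      eval (fun p : T × Fin k ↦ μ₁ p.1 p.2) (hcProj T k ((b j : Z[k]) : 𝔘[k])) = 0 := by
    intro j hj μ₁
    have h1 := congrArg (pevalLeft (l := l) μ₁) hy
    rw [map_zero, map_finsuppSum, map_finsuppSum, Finsupp.sum] at h1
    have h2 : ∑ j ∈ b.support, eval (fun p : T × Fin k ↦ μ₁ p.1 p.2) (hcProj T k ((b j : Z[k]) : 𝔘[k])) •
        hcProj T l ((ℬ j : Z[l]) : 𝔘[l]) = 0 := by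
      rw [← h1]
      refine Finset.sum_congr rfl fun j _ ↦ ?_
      rw [blockPoly_tmul, map_mul, pevalLeft_hcPolyLeft, pevalLeft_hcPolyRight, smul_eq_C_mul]
    exact linearIndependent_iff'.mp hind b.support _ h2 j hj
  -- hence `a_j = 0` for all `j`
  have hb : ∀ j ∈ b.support, b j = 0 := by
    intro j hj
    have h0 : hcProj T k ((b j : Z[k]) : 𝔘[k]) = 0 :=
      MvPolynomial.funext fun μ ↦ by rw [map_zero]; exact hcoef j hj fun τ a ↦ μ (τ, a)
    exact Subtype.ext (eq_zero_of_hcProj_eq_zero (b j).2 h0)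
  rw [Finsupp.sum]
  exact Finset.sum_eq_zero fun j hj ↦ by rw [hb j hj, zero_tmul]

end BlockPoly

/-! ### The Weyl orbit product -/

section Orbit

variable (T) (n : ℕ)

omit [Fintype T] [DecidableEq T] in
/-- Composing the `τ`-wise permutations of the variables. [folklore] -/
theorem prodCongrRight_mul (σ σ' : T → Equiv.Perm (Fin n)) :
    (⇑(Equiv.prodCongrRight σ) ∘ ⇑(Equiv.prodCongrRight σ') : T × Fin n → T × Fin n) =
      ⇑(Equiv.prodCongrRight (σ * σ')) := by
  funext ⟨τ, i⟩
  rfl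

/-- **The Weyl orbit product** of a polynomial `p` on `𝔥^*`: `∏_{σ ∈ W} (Y - σ·p) ∈ ℂ[x][Y]`, over the
Weyl group `W = ∏_τ 𝔖_n` of `𝔤𝔩_n(ℂ)^T` acting by `τ`-wise permutation of the variables. Its
coefficients are `W`-invariant and `p` is a root. [folklore] -/
def weylOrbitProd (p : MvPolynomial (T × Fin n) ℂ) : Polynomial (MvPolynomial (T × Fin n) ℂ) :=
  ∏ σ : T → Equiv.Perm (Fin n), (Polynomial.X - Polynomial.C (rename (Equiv.prodCongrRight σ) p))

/-- The orbit product is monic. [folklore] -/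
theorem monic_weylOrbitProd (p : MvPolynomial (T × Fin n) ℂ) : (weylOrbitProd T n p).Monic :=
  Polynomial.monic_prod_of_monic _ _ fun _ _ ↦ Polynomial.monic_X_sub_C _

/-- `p` is a root of its orbit product. [folklore] -/
theorem eval_weylOrbitProd_self (p : MvPolynomial (T × Fin n) ℂ) : Polynomial.eval p (weylOrbitProd T n p) = 0 := by
  rw [weylOrbitProd, Polynomial.eval_prod]
  refine Finset.prod_eq_zero (Finset.mem_univ (1 : T → Equiv.Perm (Fin n))) ?_
  rw [Polynomial.eval_sub, Polynomial.eval_X, Polynomial.eval_C, sub_eq_zero]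
  have e : (⇑(Equiv.prodCongrRight (1 : T → Equiv.Perm (Fin n))) : T × Fin n → T × Fin n) = id := by
    funext ⟨τ, i⟩
    rfl
  rw [e, rename_id_apply]

/-- **The coefficients of the orbit product are `W`-symmetric.** [folklore] -/
theorem coeff_weylOrbitProd_mem (p : MvPolynomial (T × Fin n) ℂ) (i : ℕ) :
    (weylOrbitProd T n p).coeff i ∈ blockSymmetricSubalgebra T n ℂ := by
  intro σ'
  have key : Polynomial.map ((rename (Equiv.prodCongrRight σ') :
      MvPolynomial (T × Fin n) ℂ →ₐ[ℂ] MvPolynomial (T × Fin n) ℂ) : MvPolynomial (T × Fin n) ℂ →+* MvPolynomial (T × Fin n) ℂ)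
      (weylOrbitProd T n p) = weylOrbitProd T n p := by
    rw [weylOrbitProd, Polynomial.map_prod]
    refine Fintype.prod_equiv (Equiv.mulLeft σ') _ _ fun σ ↦ ?_
    rw [Polynomial.map_sub, Polynomial.map_X, Polynomial.map_C, RingHom.coe_coe, rename_rename, prodCongrRight_mul]
    rfl
  have h := congrArg (fun q ↦ Polynomial.coeff q i) key
  simp only [Polynomial.coeff_map, RingHom.coe_coe] at h
  exact h

end Orbit

/-! ### Linear orders on the index types -/

section Orders

variable (T) (n : ℕ)

/-- The lexicographic sort key `(τ, a, b)` of an index (with an arbitrary enumeration of `T`).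
[folklore] -/
def lexKey (i : Idx T n) : Lex (ℕ × Lex (ℕ × ℕ)) :=
  toLex ((Fintype.equivFin T i.1 : ℕ), toLex ((i.2.1 : ℕ), (i.2.2 : ℕ)))

omit [DecidableEq T] in
/-- The lexicographic key is injective. [folklore] -/
theorem lexKey_injective : Function.Injective (lexKey T n) := by
  rintro ⟨τ, a, b⟩ ⟨τ', a', b'⟩ h
  simp only [lexKey, Prod.mk.injEq, EmbeddingLike.apply_eq_iff_eq, Fin.val_inj] at h
  obtain ⟨rfl, rfl, rfl⟩ := h
  rfl

/-- **The lexicographic linear order** on the indices `T × Fin n × Fin n` (used for the PBW bases of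
the two Levi blocks). Registered only locally, inside proofs (Mathlib puts no linear order on
products; cf. `HCCore.idxLinearOrder`). [folklore] -/
@[reducible]
def lexOrder : LinearOrder (Idx T n) :=
  { LinearOrder.lift' (lexKey T n) (lexKey_injective T n) with
    toDecidableEq := inferInstance
    compare_eq_compareOfLessAndEq := fun a b ↦ by
      convert (LinearOrder.lift' (lexKey T n) (lexKey_injective T n)).compare_eq_compareOfLessAndEq a b }

variable (k l)

/-- The sort key of the parabolic order: zone first (`𝔲⁻ < 𝔪₁ < 𝔪₂ < 𝔲`), then lexicographic.
[folklore] -/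
def parabolicKey (i : Idx T (k + l)) : Lex (ℕ × Lex (ℕ × Lex (ℕ × ℕ))) :=
  toLex (zone k i, lexKey T (k + l) i)

omit [DecidableEq T] in
/-- The parabolic key is injective. [folklore] -/
theorem parabolicKey_injective : Function.Injective (parabolicKey T k l) := fun _ _ h ↦
  lexKey_injective T (k + l) (congrArg (fun x ↦ (ofLex x).2) h :)

/-- **The parabolic linear order** on the indices of `𝔤 T (k+l)`: `𝔲⁻ < 𝔪₁ < 𝔪₂ < 𝔲`, refined
lexicographically (the order required by `HarishChandraParabolicProjection` and
`HarishChandraLeviBlocks`). Registered only locally, inside proofs. [folklore] -/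
@[reducible]
def parabolicOrder : LinearOrder (Idx T (k + l)) :=
  { LinearOrder.lift' (parabolicKey T k l) (parabolicKey_injective T k l) with
    toDecidableEq := inferInstance
    compare_eq_compareOfLessAndEq := fun a b ↦ by
      convert (LinearOrder.lift' (parabolicKey T k l) (parabolicKey_injective T k l)).compare_eq_compareOfLessAndEq a b }

/-- The parabolic order refines the zone order. [folklore] -/
theorem zone_mono_parabolicOrder {i j : Idx T (k + l)} (h : (parabolicOrder T k l).le i j) : zone k i ≤ zone k j := by
  change parabolicKey T k l i ≤ parabolicKey T k l j at h
  rcases Prod.Lex.le_iff.mp h with h | ⟨h, -⟩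
  · exact le_of_lt h
  · exact le_of_eq h

omit [DecidableEq T] in
/-- The lexicographic key of an embedded index of the first block. [folklore] -/
theorem lexKey_embL (i : Idx T k) : lexKey T (k + l) (embL (l := l) i) = lexKey T k i := by
  simp only [lexKey, embL, Fin.val_castAdd]

omit [Fintype T] [DecidableEq T] in
/-- The zone of an embedded index of the first block is `1`. [folklore] -/
theorem zone_embL (i : Idx T k) : zone k (embL (l := l) i) = 1 := by
  simp only [zone, embL, Fin.val_castAdd, i.2.1.2, i.2.2.2, if_true]

omit [Fintype T] [DecidableEq T] in
/-- The zone of an embedded index of the second block is `2`. [folklore] -/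
theorem zone_embR (j : Idx T l) : zone k (embR (k := k) j) = 2 := by
  simp only [zone, embR, Fin.val_natAdd]
  split_ifs <;> omega

/-- **The first block embedding is increasing** (lexicographic order on the block, parabolic order
on `𝔤 T (k+l)`). [folklore] -/
theorem strictMono_embL :
    @StrictMono (Idx T k) (Idx T (k + l)) (lexOrder T k).toPreorder (parabolicOrder T k l).toPreorder
      (embL (l := l)) := by
  intro i j h
  change parabolicKey T k l (embL i) < parabolicKey T k l (embL j)
  change lexKey T k i < lexKey T k j at h
  rw [parabolicKey, parabolicKey, zone_embL, zone_embL, lexKey_embL, lexKey_embL, Prod.Lex.lt_iff]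
  exact Or.inr ⟨rfl, h⟩

omit [DecidableEq T] in
/-- Shifting both coordinates by `k` is increasing for the lexicographic order. [folklore] -/
theorem lexKey_embR_lt_iff (i j : Idx T l) :
    lexKey T (k + l) (embR (k := k) i) < lexKey T (k + l) (embR (k := k) j) ↔ lexKey T l i < lexKey T l j := by
  simp only [lexKey, embR, Fin.val_natAdd, Prod.Lex.lt_iff, ofLex_toLex]
  omega

/-- **The second block embedding is increasing.** [folklore] -/
theorem strictMono_embR :
    @StrictMono (Idx T l) (Idx T (k + l)) (lexOrder T l).toPreorder (parabolicOrder T k l).toPreorder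
      (embR (k := k)) := by
  intro i j h
  change parabolicKey T k l (embR i) < parabolicKey T k l (embR j)
  change lexKey T l i < lexKey T l j at h
  rw [parabolicKey, parabolicKey, zone_embR, zone_embR, Prod.Lex.lt_iff]
  exact Or.inr ⟨rfl, (lexKey_embR_lt_iff T k l i j).mpr h⟩

/-- **The first block precedes the second** in the parabolic order. [folklore] -/
theorem embL_lt_embR (i : Idx T k) (j : Idx T l) : (parabolicOrder T k l).lt (embL i) (embR j) := by
  change parabolicKey T k l (embL i) < parabolicKey T k l (embR j)
  rw [parabolicKey, parabolicKey, zone_embL, zone_embR, Prod.Lex.lt_iff]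
  exact Or.inl one_lt_two

end Orders

/-! ### The main theorem -/

section Main

local notation "𝔘[" m "]" => UniversalEnvelopingAlgebra ℂ (𝔤 T m)
local notation "Z[" m "]" => Subalgebra.center ℂ (UniversalEnvelopingAlgebra ℂ (𝔤 T m))

omit [Fintype T] [DecidableEq T] in
/-- `ι(H₀)` lies in the image of `leviMap`: `ι(H₀) = leviMap(ι(1) ⊗ 1)`. [folklore] -/
theorem ι_H0_eq_leviMap : ι ℂ (H0 T k l) = leviMap T k l (ι ℂ (1 : 𝔤 T k) ⊗ₜ (1 : 𝔘[l])) := by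
  rw [leviMap_tmul, jLeft_ι, inclLeft_one, map_one, mul_one]

variable (k l) in
/-- **`Z(𝔪)` is integral over `Z(𝔤)` modulo `U(𝔤)𝔲`** (complex core, for any Harish-Chandra
homomorphism `γ'` with the highest weight property and `W`-symmetric values): for every `y` in the
centre `Z(U(𝔤 T k)) ⊗ Z(U(𝔤 T l))` of `U(𝔪)` there are `d` and central `c₀, …, c_{d-1} ∈ Z(U(𝔤))`
with `leviMap(y)^d + ∑_{i<d} c_i · leviMap(y)^i ∈ U(𝔤)𝔲`. Equivalent to: `Z(𝔪)` is a finitely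
generated module over `μ_𝔭(Z(𝔤))` (Harish-Chandra); Moeglin–Waldspurger 1995, I.2.17
("`𝔷^M` est un `i(𝔷)`-module de type fini", [HC2]); Knapp–Vogan 1995, Thm. 4.95 and §IV.8.
[cite: MoeglinWaldspurger1995, I.2.17] -/
theorem exists_monic_mem_uIdeal {c : T × Fin (k + l) → ℂ}
    {γ' : Subalgebra.center ℂ 𝔘[k + l] →ₐ[ℂ] MvPolynomial (T × Fin (k + l)) ℂ} (hγ : HasHWProperty c γ')
    (hsym : ∀ z, γ' z ∈ blockSymmetricSubalgebra T (k + l) ℂ) (y : Z[k] ⊗[ℂ] Z[l]) :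
    ∃ (d : ℕ) (cz : ℕ → 𝔘[k + l]), (∀ i, cz i ∈ Subalgebra.center ℂ 𝔘[k + l]) ∧
      leviMap T k l (Algebra.TensorProduct.map (Subalgebra.center ℂ 𝔘[k]).val (Subalgebra.center ℂ 𝔘[l]).val y) ^ d +
        ∑ i ∈ Finset.range d, cz i * leviMap T k l (Algebra.TensorProduct.map (Subalgebra.center ℂ 𝔘[k]).val
          (Subalgebra.center ℂ 𝔘[l]).val y) ^ i ∈ uIdeal T k l := by
  classical
  -- notation
  set M : Z[k] ⊗[ℂ] Z[l] →ₐ[ℂ] 𝔘[k] ⊗[ℂ] 𝔘[l] :=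
    Algebra.TensorProduct.map (Subalgebra.center ℂ 𝔘[k]).val (Subalgebra.center ℂ 𝔘[l]).val with hM
  set Y : 𝔘[k + l] := leviMap T k l (M y) with hY
  -- the Harish-Chandra polynomial of `y`, shifted, and its orbit product
  set p : MvPolynomial (T × Fin (k + l)) ℂ := shiftPoly c (blockPoly T k l y) with hp
  set Q := weylOrbitProd T (k + l) p with hQ
  set d := Q.natDegree with hd
  have hrange := (injective_and_range_eq_of_hasHWProperty hγ hsym).2
  have hcoef : ∀ i, ∃ z : Subalgebra.center ℂ 𝔘[k + l], γ' z = Q.coeff i := fun i ↦ by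
    have h : Q.coeff i ∈ γ'.range := by rw [hrange]; exact coeff_weylOrbitProd_mem T (k + l) p i
    exact (AlgHom.mem_range _).mp h
  choose cz hcz using hcoef
  refine ⟨d, fun i ↦ (cz i : 𝔘[k + l]), fun i ↦ (cz i).2, ?_⟩
  set q := Y ^ d + ∑ i ∈ Finset.range d, (cz i : 𝔘[k + l]) * Y ^ i with hq
  -- Step 1: `q` kills every highest weight vector
  have hkill : ∀ (V : Type) [AddCommGroup V] [Module ℂ V] (ρ : 𝔤 T (k + l) →ₗ⁅ℂ⁆ Module.End ℂ V)
      (lam : T → Fin (k + l) → ℂ) (v : V), IsHighestWeightVectorC ρ lam v → lift ℂ ρ q v = 0 := by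
    intro V _ _ ρ lam v hv
    set s := eval (fun r ↦ lam r.1 r.2) (blockPoly T k l y) with hs
    have hYv : ∀ i : ℕ, lift ℂ ρ (Y ^ i) v = (s ^ i) • v := by
      intro i
      induction i with
      | zero => rw [pow_zero, pow_zero, map_one, one_smul]; rfl
      | succ i ih =>
        rw [pow_succ, map_mul, Module.End.mul_apply, hY, lift_leviMap_center_hw hv y, ← hs, ← hY, map_smul, ih,
          smul_smul, ← pow_succ']
    -- the scalar by which `q` acts
    set x : T × Fin (k + l) → ℂ := fun r ↦ lam r.1 r.2 + c r with hx
    have hsp : eval x p = s := by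
      rw [hp, eval_shiftPoly]
      have e : (fun r : T × Fin (k + l) ↦ x r - c r) = fun r ↦ lam r.1 r.2 := by
        funext r; simp only [hx, add_sub_cancel_right]
      rw [e]
    have hroot := congrArg (eval x) (eval_weylOrbitProd_self T (k + l) p)
    rw [(monic_weylOrbitProd T (k + l) p).as_sum] at hroot
    simp only [Polynomial.eval_add, Polynomial.eval_pow, Polynomial.eval_X, Polynomial.eval_finsetSum,
      Polynomial.eval_mul, Polynomial.eval_C, map_add, map_pow, map_sum, map_mul, map_zero, hsp] at hroot
    -- compute `q v`
    rw [hq, map_add, map_sum, LinearMap.add_apply, LinearMap.sum_apply, hYv d]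
    have hterm : ∀ i ∈ Finset.range d, lift ℂ ρ ((cz i : 𝔘[k + l]) * Y ^ i) v = (eval x (Q.coeff i) * s ^ i) • v := by
      intro i _
      rw [map_mul, Module.End.mul_apply, hYv i, map_smul, hγ V ρ lam v hv (cz i), hcz i, smul_smul, mul_comm]
      rfl
    rw [Finset.sum_congr rfl hterm, ← Finset.sum_smul, ← add_smul, hroot, zero_smul]
  -- Step 2: `q` commutes with `ι(H₀)`
  have hcommY : ι ℂ (H0 T k l) * Y = Y * ι ℂ (H0 T k l) := by
    rw [ι_H0_eq_leviMap, hY, hM]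
    exact leviMap_center_comm y _
  have hcommq : ι ℂ (H0 T k l) * q = q * ι ℂ (H0 T k l) := by
    have hc : Commute (ι ℂ (H0 T k l)) Y := hcommY
    have h : Commute (ι ℂ (H0 T k l)) q := by
      rw [hq]
      refine (hc.pow_right d).add_right (Commute.sum_right _ _ _ fun i _ ↦ ?_)
      have hci : Commute (ι ℂ (H0 T k l)) (cz i : 𝔘[k + l]) := Subalgebra.mem_center_iff.mp (cz i).2 _
      exact hci.mul_right (hc.pow_right i)
    exact h
  -- Step 3: the orders and the decomposition `q = μ(q) + r`
  letI : LinearOrder (Idx T (k + l)) := parabolicOrder T k l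
  letI : LinearOrder (Idx T k) := lexOrder T k
  letI : LinearOrder (Idx T l) := lexOrder T l
  have hz : ∀ ⦃i j : Idx T (k + l)⦄, i ≤ j → zone k i ≤ zone k j := fun i j h ↦ zone_mono_parabolicOrder T k l h
  have hL : StrictMono (embL (T := T) (k := k) (l := l)) := strictMono_embL T k l
  have hR : StrictMono (embR (T := T) (k := k) (l := l)) := strictMono_embR T k l
  have hLR : ∀ (i : Idx T k) (j : Idx T l), embL (l := l) i < embR (k := k) j := embL_lt_embR T k l
  have hr : q - leviProj T k l q ∈ uIdeal T k l := sub_leviProj_mem_uIdeal hz hcommq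
  -- Step 4: `μ(q) = leviMap(M y')` for an explicit `y'`
  have htc : ∀ i, ∃ t : Z[k] ⊗[ℂ] Z[l], leviMap T k l (M t) = leviProj T k l (cz i) := fun i ↦
    exists_center_tmul_eq_leviProj hL hR hLR hz (cz i).2
  choose tc htc using htc
  set y' := y ^ d + ∑ i ∈ Finset.range d, tc i * y ^ i with hy'
  have hYmem : ∀ i, Y ^ i ∈ leviSpan T k l := fun i ↦ by
    rw [← range_leviMap_eq_leviSpan hL hR hLR, hY, ← map_pow]
    exact ⟨_, rfl⟩
  have hproj : leviProj T k l q = leviMap T k l (M y') := by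
    rw [hq, map_add, map_sum, leviProj_of_mem_leviSpan (hYmem d), hy', map_add, map_pow, map_sum, map_add, map_pow,
      map_sum, ← hY]
    congr 1
    refine Finset.sum_congr rfl fun i _ ↦ ?_
    rw [leviProj_mul hL hR hLR hz (sub_leviProj_mem_uIdeal_of_mem_center hz (cz i).2)
      (sub_leviProj_mem_uIdeal_of_mem_leviSpan (hYmem i)), leviProj_of_mem_leviSpan (hYmem i), ← htc i, map_mul,
      map_pow, map_mul, map_pow]
  -- Step 5: `leviMap(M y')` kills highest weight vectors, hence `y' = 0`
  have hkill' : ∀ (V : Type) [AddCommGroup V] [Module ℂ V] (ρ : 𝔤 T (k + l) →ₗ⁅ℂ⁆ Module.End ℂ V)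
      (lam : T → Fin (k + l) → ℂ) (v : V), IsHighestWeightVectorC ρ lam v → lift ℂ ρ (leviMap T k l (M y')) v = 0 := by
    intro V _ _ ρ lam v hv
    have e : leviMap T k l (M y') = q - (q - leviProj T k l q) := by rw [hproj]; abel
    rw [e, map_sub, LinearMap.sub_apply, hkill V ρ lam v hv, lift_eq_zero_of_mem_uIdeal hv hr, sub_zero]
  have hy'0 : y' = 0 := by
    refine blockPoly_injective ?_
    rw [map_zero]
    refine eq_zero_of_forall_eval_antitone_eq_zero (fun _ ↦ (0 : ℂ)) _ fun lam hlam ↦ ?_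
    obtain ⟨V, _, _, ρ, v, hv⟩ := exists_isHighestWeightVectorC_of_antitone (R := ℂ) lam hlam
    have h1 := lift_leviMap_center_hw hv y'
    rw [← hM, hkill' V ρ _ v hv] at h1
    have h2 := (smul_eq_zero.mp h1.symm).resolve_right hv.1
    simpa only [add_zero] using h2
  -- conclusion: `q = r ∈ U(𝔤)𝔲`
  have hq0 : leviProj T k l q = 0 := by rw [hproj, hy'0, map_zero, map_zero]
  rw [hq0, sub_zero] at hr
  exact hr

end Main

/-! ### The real forms `𝔤𝔩_n(ℝ)`, `𝔤𝔩_n(ℂ)` -/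

section RealForms

variable {𝕜 : Type*} [RCLike 𝕜]

/-- **`Z(𝔪)` is integral over `Z(𝔤)` modulo `U(𝔤)𝔲` for `𝔤 = 𝔤𝔩_{k+l}(𝕜)_ℂ = ∏_{τ : 𝕜 →ₐ[ℝ] ℂ} 𝔤𝔩_{k+l}(ℂ)`**
(`𝕜 = ℝ` or `ℂ`) and its maximal parabolic `𝔭_k` with Levi `𝔪 = 𝔤𝔩_k × 𝔤𝔩_l`: for every `y` in the
centre `Z(U(𝔤𝔩_k^T)) ⊗ Z(U(𝔤𝔩_l^T))` of `U(𝔪)` there are central `c₀, …, c_{d-1} ∈ Z(U(𝔤))` with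
`leviMap(y)^d + ∑_{i<d} c_i leviMap(y)^i ∈ U(𝔤)𝔲` — from `exists_monic_mem_uIdeal` and
Harish-Chandra's theorem for `𝔤𝔩_n(𝕜)` (`HarishChandraHomGL.hasHWProperty_complexified`,
`complexified_mem`). This is the algebraic input making the constant terms of `Z(𝔤)`-finite functions
along `P_k` `Z(𝔪)`-finite (Moeglin–Waldspurger 1995, I.2.17; Borel–Jacquet 1979, 4.3–4.4).
[cite: MoeglinWaldspurger1995, I.2.17] -/
theorem exists_monic_mem_uIdeal_gl (k l : ℕ)
    (y : Subalgebra.center ℂ (UniversalEnvelopingAlgebra ℂ (𝔤 (𝕜 →ₐ[ℝ] ℂ) k)) ⊗[ℂ]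
      Subalgebra.center ℂ (UniversalEnvelopingAlgebra ℂ (𝔤 (𝕜 →ₐ[ℝ] ℂ) l))) :
    ∃ (d : ℕ) (cz : ℕ → UniversalEnvelopingAlgebra ℂ (𝔤 (𝕜 →ₐ[ℝ] ℂ) (k + l))),
      (∀ i, cz i ∈ Subalgebra.center ℂ (UniversalEnvelopingAlgebra ℂ (𝔤 (𝕜 →ₐ[ℝ] ℂ) (k + l)))) ∧
      leviMap (𝕜 →ₐ[ℝ] ℂ) k l (Algebra.TensorProduct.map
          (Subalgebra.center ℂ (UniversalEnvelopingAlgebra ℂ (𝔤 (𝕜 →ₐ[ℝ] ℂ) k))).val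
          (Subalgebra.center ℂ (UniversalEnvelopingAlgebra ℂ (𝔤 (𝕜 →ₐ[ℝ] ℂ) l))).val y) ^ d +
        ∑ i ∈ Finset.range d, cz i * leviMap (𝕜 →ₐ[ℝ] ℂ) k l (Algebra.TensorProduct.map
          (Subalgebra.center ℂ (UniversalEnvelopingAlgebra ℂ (𝔤 (𝕜 →ₐ[ℝ] ℂ) k))).val
          (Subalgebra.center ℂ (UniversalEnvelopingAlgebra ℂ (𝔤 (𝕜 →ₐ[ℝ] ℂ) l))).val y) ^ i ∈
        uIdeal (𝕜 →ₐ[ℝ] ℂ) k l := by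
  classical
  exact exists_monic_mem_uIdeal k l (harishChandraHomGL 𝕜 (k + l)).hasHWProperty_complexified
    (harishChandraHomGL 𝕜 (k + l)).complexified_mem y

end RealForms

end Literature.NumberTheory.Automorphic.HCLevi
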